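import Summits.Ventures.PercRepro.C026PFunTwoLiveNonneg

/-!
# THEOREM L2 with a bare probe: `(E00)` ⟹ `(P) ≥ 0` at every band state of two live vertices
(p6, gen 17; mine-3 §35 (b))

With probe `c` bare and two live vertices `a, b` at band states `(x₁, K₁)`, `(x₂, K₂)`
(`0 ≤ x ≤ 1`, `K ≥ K_min(x)`), the `(P)` functional over the whole edge set is nonnegative as
soon as it is nonnegative at the all-corner state `(x, K) = (0, 0), (0, 0)` — the corner
identity `(E00)`, which `C026PFunCorner` identifies with `2·slackCF + #{c ~ a ~ b} ≥ 0`.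

* `pFun_twoCells_nonneg_of_half`: `(P) ≥ 0` whenever `½ ≤ x₁` or `½ ≤ x₂` — every symmetrised
  pair value is nonnegative there (`twoLiveVal_add_nonneg`) and `(P) = ½ ∑_ω (val(ω) + val(ωᶜ))`;
* on the piece `x₁, x₂ ≤ ½` the lower corner is `K₁ = K₂ = 0` (`pFun_mono_K`), where `(P)` is
  bilinear in `(x₁, x₂)` (`twoLiveVal_zero_interp`, `pFun_twoCells_zero_interp`), hence a convex
  combination of its values at `(0, 0), (½, 0), (0, ½), (½, ½)` — three of them covered by the
  first item, the fourth being `(E00)`;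
* **`pFun_twoCells_nonneg_of_corner`** (THEOREM L2, bare probe: `(E00) ⟹ (P) ≥ 0`) and
  **`pFun_twoCells_nonneg_of_slackCF`** (`(CF)` on the skeleton ⟹ THEOREM L2);
* `pFun_oneCell_nonneg`: with ONE live vertex `(P) ≥ 0` unconditionally (`k = 1`).
  (The parabola `K = x²` of mine-3 §31 is inside the band, `kMin_le_sq` in `C026PFunParabola`, so
  `(P_par) ≥ 0` for two live vertices follows from THEOREM L2 by one application.)
-/

namespace PercRepro

namespace MultiGraph

open Finset

variable {V E : Type*} [Fintype V] [DecidableEq V]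

omit [Fintype V] in
/-- Two-live cells in `[0, 1]` lie in `[0, 1]`. -/
theorem twoCells_mem (a b : V) {x₁ x₂ : ℝ} (hx₁ : 0 ≤ x₁ ∧ x₁ ≤ 1) (hx₂ : 0 ≤ x₂ ∧ x₂ ≤ 1)
    (v : V) : 0 ≤ twoCells a b x₁ x₂ v ∧ twoCells a b x₁ x₂ v ≤ 1 := by
  unfold twoCells
  split_ifs <;> constructor <;> nlinarith [hx₁.1, hx₁.2, hx₂.1, hx₂.2]

omit [Fintype V] in
/-- Two-live cells are monotone in the two live values (nonnegative cells). -/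
theorem twoCells_le_twoCells (a b : V) {K₁ K₂ K₁' K₂' : ℝ} (h₁ : 0 ≤ K₁) (h₂ : 0 ≤ K₂)
    (h₁' : K₁ ≤ K₁') (h₂' : K₂ ≤ K₂') (v : V) :
    twoCells a b K₁ K₂ v ≤ twoCells a b K₁' K₂' v := by
  unfold twoCells
  split_ifs <;> nlinarith

variable [Fintype E] [DecidableEq E] {G : MultiGraph V E}

open Classical in
/-- **`(P) ≥ 0` off the piece `x₁, x₂ ≤ ½`**: for two live vertices at band states with
`½ ≤ x₁` or `½ ≤ x₂` (bare probe), `(P) ≥ 0`. -/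
theorem pFun_twoCells_nonneg_of_half (a b c : V) {x₁ K₁ x₂ K₂ : ℝ} (h₁ : BandState x₁ K₁)
    (h₂ : BandState x₂ K₂) (hhalf : 1 / 2 ≤ x₁ ∨ 1 / 2 ≤ x₂) :
    0 ≤ G.pFun c (twoCells a b x₁ x₂) (twoCells a b K₁ K₂) univ := by
  rw [pFun_twoCells_eq_sum a b c ⟨h₁.x0, h₁.x1⟩ ⟨h₂.x0, h₂.x1⟩]
  have hsym : ∀ f : Config E → ℝ, ∑ ω, f ω = (∑ ω, (f ω + f ωᶜ)) / 2 := by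
    intro f
    rw [Finset.sum_add_distrib, sum_compl_config_eq f]
    ring
  rw [hsym]
  refine div_nonneg (Finset.sum_nonneg fun ω _ => ?_) (by norm_num)
  simp only [compl_compl]
  exact twoLiveVal_add_nonneg h₁ h₂ hhalf _ _ _ _ _ _
    (fun h1 h2 => h1.symm.trans h2) (fun h1 h2 => h1.trans h2) (fun h1 h2 => h1.trans h2.symm)
    (fun h1 h2 => h1.symm.trans h2) (fun h1 h2 => h1.trans h2) (fun h1 h2 => h1.trans h2.symm)

omit [Fintype V] [DecidableEq V] [Fintype E] [DecidableEq E] in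
/-- At `K₁ = K₂ = 0` the summand is bilinear in `(x₁, x₂)`: the Lagrange interpolation on
`{0, ½}²`. -/
theorem twoLiveVal_zero_interp (x₁ x₂ : ℝ) (ra rb rab bab : Prop) [Decidable ra] [Decidable rb]
    [Decidable rab] [Decidable bab] :
    twoLiveVal x₁ 0 x₂ 0 ra rb rab bab =
      (1 - 2 * x₁) * (1 - 2 * x₂) * twoLiveVal 0 0 0 0 ra rb rab bab +
        (2 * x₁) * (1 - 2 * x₂) * twoLiveVal (1 / 2) 0 0 0 ra rb rab bab +
        (1 - 2 * x₁) * (2 * x₂) * twoLiveVal 0 0 (1 / 2) 0 ra rb rab bab +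
        (2 * x₁) * (2 * x₂) * twoLiveVal (1 / 2) 0 (1 / 2) 0 ra rb rab bab := by
  unfold twoLiveVal
  split_ifs <;> ring

open Classical in
/-- **`(P)` is bilinear on the piece `K₁ = K₂ = 0`**: the Lagrange interpolation on `{0, ½}²`. -/
theorem pFun_twoCells_zero_interp (a b c : V) {x₁ x₂ : ℝ} (hx₁ : 0 ≤ x₁ ∧ x₁ ≤ 1)
    (hx₂ : 0 ≤ x₂ ∧ x₂ ≤ 1) :
    G.pFun c (twoCells a b x₁ x₂) (twoCells a b 0 0) univ =
      (1 - 2 * x₁) * (1 - 2 * x₂) * G.pFun c (twoCells a b 0 0) (twoCells a b 0 0) univ +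
        (2 * x₁) * (1 - 2 * x₂) * G.pFun c (twoCells a b (1 / 2) 0) (twoCells a b 0 0) univ +
        (1 - 2 * x₁) * (2 * x₂) * G.pFun c (twoCells a b 0 (1 / 2)) (twoCells a b 0 0) univ +
        (2 * x₁) * (2 * x₂) * G.pFun c (twoCells a b (1 / 2) (1 / 2)) (twoCells a b 0 0) univ := by
  have h0 : (0 : ℝ) ≤ 0 ∧ (0 : ℝ) ≤ 1 := by norm_num
  have hh : (0 : ℝ) ≤ 1 / 2 ∧ (1 / 2 : ℝ) ≤ 1 := by norm_num
  rw [pFun_twoCells_eq_sum a b c hx₁ hx₂ 0 0, pFun_twoCells_eq_sum a b c h0 h0 0 0,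
    pFun_twoCells_eq_sum a b c hh h0 0 0, pFun_twoCells_eq_sum a b c h0 hh 0 0,
    pFun_twoCells_eq_sum a b c hh hh 0 0]
  simp only [Finset.mul_sum, ← Finset.sum_add_distrib]
  exact Finset.sum_congr rfl fun ω _ => twoLiveVal_zero_interp x₁ x₂ _ _ _ _

/-- `BandState 0 0` and `BandState (1/2) 0`: the two lower corners of the zero piece. -/
theorem bandState_zero_zero : BandState (0 : ℝ) 0 := ⟨by norm_num, by norm_num, le_rfl, by norm_num⟩

/-- The corner `(½, 0)` is a band state. -/
theorem bandState_half_zero : BandState (1 / 2 : ℝ) 0 :=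
  ⟨by norm_num, by norm_num, le_rfl, by norm_num⟩

open Classical in
/-- **THEOREM L2, bare probe** (mine-3 §35 (b)): if `(P)` is nonnegative at the all-corner state
`(E00)`, it is nonnegative at every band state of the two live vertices `a, b` (every other
vertex bare, the probe bare). -/
theorem pFun_twoCells_nonneg_of_corner (a b c : V) {x₁ K₁ x₂ K₂ : ℝ} (hx₁ : 0 ≤ x₁ ∧ x₁ ≤ 1)
    (hx₂ : 0 ≤ x₂ ∧ x₂ ≤ 1) (hK₁ : kMin x₁ ≤ K₁) (hK₂ : kMin x₂ ≤ K₂)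
    (hE00 : 0 ≤ G.pFun c (liveCells a b) (liveCells a b) univ) :
    0 ≤ G.pFun c (twoCells a b x₁ x₂) (twoCells a b K₁ K₂) univ := by
  have b₁ := bandState_of_kMin_le hx₁ hK₁
  have b₂ := bandState_of_kMin_le hx₂ hK₂
  by_cases hhalf : 1 / 2 ≤ x₁ ∨ 1 / 2 ≤ x₂
  · exact pFun_twoCells_nonneg_of_half a b c b₁ b₂ hhalf
  · have hx₁' : x₁ ≤ 1 / 2 := by
      by_contra h
      exact hhalf (Or.inl (by linarith))
    have hx₂' : x₂ ≤ 1 / 2 := by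
      by_contra h
      exact hhalf (Or.inr (by linarith))
    -- descend to the lower corner `K₁ = K₂ = 0`
    have hmono : G.pFun c (twoCells a b x₁ x₂) (twoCells a b 0 0) univ ≤
        G.pFun c (twoCells a b x₁ x₂) (twoCells a b K₁ K₂) univ :=
      pFun_mono_K (twoCells_mem a b hx₁ hx₂) (fun v => (twoCells_mem a b (by norm_num) (by norm_num) v).1)
        (twoCells_le_twoCells a b le_rfl le_rfl b₁.K0 b₂.K0) univ
    refine le_trans ?_ hmono
    rw [pFun_twoCells_zero_interp a b c hx₁ hx₂]
    have c00 : 0 ≤ G.pFun c (twoCells a b 0 0) (twoCells a b 0 0) univ := by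
      rwa [twoCells_zero_zero]
    have c10 : 0 ≤ G.pFun c (twoCells a b (1 / 2) 0) (twoCells a b 0 0) univ :=
      pFun_twoCells_nonneg_of_half a b c bandState_half_zero bandState_zero_zero (Or.inl le_rfl)
    have c01 : 0 ≤ G.pFun c (twoCells a b 0 (1 / 2)) (twoCells a b 0 0) univ :=
      pFun_twoCells_nonneg_of_half a b c bandState_zero_zero bandState_half_zero (Or.inr le_rfl)
    have c11 : 0 ≤ G.pFun c (twoCells a b (1 / 2) (1 / 2)) (twoCells a b 0 0) univ :=
      pFun_twoCells_nonneg_of_half a b c bandState_half_zero bandState_half_zero (Or.inl le_rfl)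
    have w1 : 0 ≤ 1 - 2 * x₁ := by linarith
    have w2 : 0 ≤ 1 - 2 * x₂ := by linarith
    have w3 : 0 ≤ 2 * x₁ := by linarith [hx₁.1]
    have w4 : 0 ≤ 2 * x₂ := by linarith [hx₂.1]
    have t1 := mul_nonneg (mul_nonneg w1 w2) c00
    have t2 := mul_nonneg (mul_nonneg w3 w2) c10
    have t3 := mul_nonneg (mul_nonneg w1 w4) c01
    have t4 := mul_nonneg (mul_nonneg w3 w4) c11
    linarith

open Classical in
/-- **`(CF)` on the skeleton ⟹ THEOREM L2 (bare probe)**: if the C-026 class slack of the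
skeleton read as the marked multigraph `(G; a, b, c)` is nonnegative, then `(P) ≥ 0` at every
band state of the two live vertices `a, b` with the probe bare. -/
theorem pFun_twoCells_nonneg_of_slackCF (a b c : V) (hCF : 0 ≤ G.slackCF a b c)
    {x₁ K₁ x₂ K₂ : ℝ} (hx₁ : 0 ≤ x₁ ∧ x₁ ≤ 1) (hx₂ : 0 ≤ x₂ ∧ x₂ ≤ 1) (hK₁ : kMin x₁ ≤ K₁)
    (hK₂ : kMin x₂ ≤ K₂) :
    0 ≤ G.pFun c (twoCells a b x₁ x₂) (twoCells a b K₁ K₂) univ :=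
  pFun_twoCells_nonneg_of_corner a b c hx₁ hx₂ hK₁ hK₂ (pFun_liveCells_nonneg_of_slackCF a b c hCF)

/-- The bare state `(1, 1)` is a band state. -/
theorem bandState_one_one : BandState (1 : ℝ) 1 := ⟨by norm_num, le_rfl, by norm_num, by norm_num⟩

omit [Fintype V] in
/-- Cells with ONE live vertex `a` at `x₁` are the two-live cells with `b = a` and `x₂ = 1`. -/
theorem twoCells_self_one (a : V) (x₁ : ℝ) :
    twoCells a a x₁ 1 = fun v => if v = a then x₁ else 1 := by
  funext v
  simp only [twoCells]
  split_ifs <;> ring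

open Classical in
/-- **One live vertex, bare probe: `(P) ≥ 0` unconditionally** (the `k = 1` case of THEOREM L2 —
no `(E00)` needed: with `x₂ = 1` every pair value is nonnegative). -/
theorem pFun_oneCell_nonneg (a c : V) {x₁ K₁ : ℝ} (hx₁ : 0 ≤ x₁ ∧ x₁ ≤ 1) (hK₁ : kMin x₁ ≤ K₁) :
    0 ≤ G.pFun c (fun v => if v = a then x₁ else 1) (fun v => if v = a then K₁ else 1) univ := by
  rw [← twoCells_self_one, ← twoCells_self_one]
  exact pFun_twoCells_nonneg_of_half a a c (bandState_of_kMin_le hx₁ hK₁) bandState_one_one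
    (Or.inr (by norm_num))

end MultiGraph

end PercRepro
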